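import Summits.QuantumFields.BalabanUV.Beta.D1BFx.DshEntrySharp

/-!
# `BalabanUV.Beta.D1BFx.DshFaceMass` — road «BF-x», binder row D1 (pricing letters for the `Dsh`-words of PART 24 HEAD (b), MASS currency, the interior∕face SPLIT —
# OWNER d1-p2 g25 W-g25-5 (b) ∕ DESIGN NOTE N-g25-1 (1) «split interior∕face per O-6′ (WANTED)»): **THE BONDS OF A BLOCK BASED IN ONE COORDINATE HYPERPLANE
# `{b′_i = v}`, `v ≠ (N−1)∕2`, CARRY ONLY `(d+1)·N^{d+1}` OF an1's COMB-WEIGHT MASS** — `Σ_α Σ_{b′ ∈ box, b′_i = v} |lam04 N α (N•Y + b′) Y| ≤ (d+1)·N^{d+1}`, ONE POWER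
# BELOW the block total `N^{d+1}·((d+1)·N)` (gan24-leaf-05 g58 `BondIndicatorGaugeL1.sum_univ_box_abs_lam04_le`); hence the `2(d+1)` geometric faces of the block carry
# `≤ 2·(d+1)²·N^{d+1}` (`3 ≤ N`) and the field–multiplier block of the border shift `Dsh N` has face mass `≤ (d+1)·N^{d+1}` per hyperplane.
# MECHANISM (leaf-01 g32 located count, memo `HOME/b2b-balaban-beta-d1-formalise-leaf-01/g32/LOCATED-COUNT-DshWords-g32.md` §5, now a theorem): a bond `(α, q)` read by the
# rooted axial contour `Γ_{root, x}` (axes `d, …, 0` in this order) AGREES WITH THE TARGET `x` IN EVERY LATER AXIS `j > α` AND WITH THE ROOT IN EVERY EARLIER AXIS `j < α`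
# (`treeGaugeAt_bondInd_ne_zero_apply`); the centred root's coordinates are `(N−1)∕2 ≠ v`, so a bond based in `{q_i = v}` is read only from axes `α ≤ i`, and then either
# `α = i` (the bond's base point is pinned by the target) or the target itself lies in the hyperplane — `N^{d+1}` pairs per axis instead of `N^{d+2}`.

HONEST DEPENDENCY (cell records, verbatim): «continuum YM on T⁴ ⇐ BetaPertH ∧ nine spine estimates (0/9 proved); BetaPertH ⇐ (D1) ∧ (D4) ∧
CAP+tail; G-an2-4 gates asym, D1 and NE2/3/4.»  HONEST FRAMING (cell contract, verbatim): «discharging `BetaPertH` makes Bałaban's UV stability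
UNCONDITIONAL — a real constructive-QFT result; it is NOT the continuum limit and NOT the Clay problem.»  THIS MODULE is [folklore] lattice-path bookkeeping over
lit-balaban's `AveragingContours.seg ∕ axialAux ∕ axial ∕ corner`, an2's `bondInd`, an1's `symTreeGaugeAt ∕ lam04 ∕ Dsh` and MY `DshEntrySharp` §1 BY NAME; it is a MASS
LETTER, it prices NO (1.22) row and changes no identity; whether the HEAD's pricing reads the block faces geometrically is the pricing seats' ruling, not this file's.
No `def`, no `def … : Prop`, nothing cited, NO printed hypothesis, 0 sorry.  0 root-level binders of row D1 discharged; (K) NOT closed; (J1) ONE OPEN ROW; NOT D1,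
NEVER «G-an2-4 closed», NOT `BetaPertH`, NOT continuum, NOT Clay.

ABSOLUTE RULE (cell charter, verbatim): «No internally-minted statement may enter as a cited fact. Every hypothesis is either kernel-proved in
this package or a verbatim quotation of a PUBLISHED theorem with page reference. The manuscript(s) under audit are NOT citable for their own
disputed steps — they are the thing under adjudication; programme-internal (2001/route/tribunal) claims are never citable.»

CONTENT.  §1 PATH LOCALISATION (`n` directions): `seg_bondInd_sum_ne_zero_apply`, `axialAux_bondInd_sum_ne_zero_apply`, **`treeGaugeAt_bondInd_ne_zero_apply`**
(`treeGaugeAt ρ (bondInd α q) N z ≠ 0 → q_j = z_j (α < j), q_j = (N•blk z + ρ)_j (j < α)`).  §2 THE HYPERPLANE COUNT at a general in-block root offset `r` with `v ≠ r_i`: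
`sum_abs_le_card_of_support`, `apply_eq_of_treeGaugeAt_ne_zero`, **`sum_hyperplane_box_abs_treeGaugeAt_le`** (`Σ_{b′: b′_i = v} Σ_{b ∈ box} |treeGaugeAt (toSite r) (bondInd α (N•Y+b′)) N (N•Y+b)|
≤ N^n` for every axis `α`).  §3 an1's COMB WEIGHTS (`d+1` directions, centred root, symmetrised): `sum_twisted_hyperplane_le`, **`sum_hyperplane_abs_lam04_le`** (`≤ (d+1)·N^{d+1}`),
**`sum_faces_abs_lam04_le`** (`3 ≤ N`: `≤ 2·(d+1)²·N^{d+1}`), the `Dsh` face masses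
**`sum_hyperplane_abs_Dsh_le`** ∕ **`sum_hyperplane_abs_Dsh_succ_le`**.
Unit `b2b-balaban-beta-d1-formalise-leaf-01` (gen 32), D1 formalisation swarm LEAF PROVER 01, road «BF-x»; OFFER O-6′.  Not in print; our bookkeeping.  No existing file touched.
-/

noncomputable section

namespace Summit.QuantumFields.BalabanUV.Beta.D1BFx.DshFaceMass

open Finset
open scoped BigOperators Nat
open Literature.MathematicalPhysics.QuantumFieldTheory
open Literature.MathematicalPhysics.QuantumFieldTheory.Balaban1983to89
open Literature.MathematicalPhysics.QuantumFieldTheory.Balaban1983to89.Beta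
open AffineAveraging (Form1 Site unitVec unitVec_apply dz box toSite)
open AveragingContours (seg segUp segDown axial axialAux corner blk blk_block)
open AveragingContoursRooted (ctr ctrOff treeGaugeAt)
open KKTFluctuationKernel (delta1)
open OneStepResolventKernel (Fib quo_zsmul proj_zsmul)
open Summit.QuantumFields.BalabanUV.Beta.AxialDressingRooted (bondInd bondInd_apply)
open Summit.QuantumFields.BalabanUV.Beta.SymmetrisedAxialPotential (symTreeGaugeAt symTreeGaugeAt_eq_sum card_perm_fin)
open Summit.QuantumFields.BalabanUV.Beta.KernelPermutation (psite psite_symm_apply)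
open Summit.QuantumFields.BalabanUV.Beta.ResolventPermutation (P1 psite_mem_box)
open Summit.QuantumFields.BalabanUV.Beta.SymmetrisedDressingMatrix (bondIndR P1_bondIndR treeGaugeAt_bondIndR psite_symm_mem_box)
open Summit.QuantumFields.BalabanUV.Beta.SymGaugeMultiplierBlockMean (bondIndR_eq_delta1)
open Summit.QuantumFields.BalabanUV.Beta.DshAn1 (lam04 Dsh Dsh_inl_inr lam04_eq_zero_of_ne_blk SymLamAt_eq_sum_symTreeGaugeAt)
open Summit.QuantumFields.BalabanUV.Beta.D1BFx.DshEntrySharp (seg_bondInd_sum_eq_zero_of_ne segUp_bondInd_sum_aux segDown_bondInd_sum_aux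
  abs_axialAux_bondInd_sum_le abs_treeGaugeAt_bondInd_le_one)

variable {n : ℕ}

/-! ## §1 Path localisation: a bond read by a rooted axial contour agrees with the target in the later axes and with the root in the earlier ones -/

/-- [folklore] A straight segment in direction `κ` from `z` reads the bond `(α, q)` only if the bond's base point lies on the segment's line: `q_j = z_j` for `j ≠ κ`. -/
theorem seg_bondInd_sum_ne_zero_apply {α κ : Fin n} {q z : Fin n → ℤ} {m : ℤ} (h : (seg (bondInd α q) z κ m).sum ≠ 0) {j : Fin n} (hj : j ≠ κ) :
    q j = z j := by
  unfold seg at h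
  split at h
  · obtain ⟨s, -, hs⟩ := (segUp_bondInd_sum_aux α κ q z _).2 h
    have e := congrFun hs j
    simp only [Pi.add_apply, Pi.smul_apply, unitVec_apply, if_neg hj, smul_zero, add_zero] at e
    exact e.symm
  · obtain ⟨s, -, hs⟩ := (segDown_bondInd_sum_aux α κ q z _).2 h
    have e := congrFun hs j
    simp only [Pi.sub_apply, Pi.smul_apply, unitVec_apply, if_neg hj, smul_zero, sub_zero] at e
    exact e.symm

/-- [folklore] The partial axial contour (axes `m−1, …, 0`) from `y` to `x` reads the bond `(α, q)` only if `q_j = x_j` for `α < j` and `q_j = y_j` for `j < α`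
(the `α`-segment starts at the corner whose later coordinates are the target's and whose earlier ones are the source's). -/
theorem axialAux_bondInd_sum_ne_zero_apply (α : Fin n) (q y x : Fin n → ℤ) :
    ∀ m : ℕ, (axialAux (bondInd α q) y x m).sum ≠ 0 → ∀ j : Fin n, j ≠ α → q j = if (α : ℕ) < j then x j else y j
  | 0, h => by simp [axialAux] at h
  | m + 1, h => by
    intro j hj
    simp only [axialAux, List.sum_append] at h
    by_cases hm : m < n
    · rw [dif_pos hm] at h
      by_cases hα : (⟨m, hm⟩ : Fin n) = α
      · have h0 : (axialAux (bondInd α q) y x m).sum = 0 := by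
          have h1 := abs_axialAux_bondInd_sum_le α q y x m
          rw [if_neg (by rw [← hα]; exact lt_irrefl m)] at h1
          exact abs_nonpos_iff.1 h1
        rw [h0, add_zero] at h
        have hjm : j ≠ (⟨m, hm⟩ : Fin n) := by rw [hα]; exact hj
        have e := seg_bondInd_sum_ne_zero_apply h hjm
        have hαm : (α : ℕ) = m := by rw [← hα]
        rw [e, hαm]
        show (if m + 1 ≤ (j : ℕ) then x j else y j) = if m < (j : ℕ) then x j else y j
        rfl
      · rw [seg_bondInd_sum_eq_zero_of_ne hα, zero_add] at h
        exact axialAux_bondInd_sum_ne_zero_apply α q y x m h j hj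
    · rw [dif_neg hm, List.sum_nil, zero_add] at h
      exact axialAux_bondInd_sum_ne_zero_apply α q y x m h j hj

/-- [folklore] **A BOND READ BY THE ROOTED TREE CONTOUR OF `z` AGREES WITH `z` IN THE LATER AXES AND WITH THE ROOT IN THE EARLIER ONES**:
`treeGaugeAt ρ (bondInd α q) N z ≠ 0 → q_j = z_j (α < j) ∧ q_j = (N•blk N z + ρ)_j (j < α)`. -/
theorem treeGaugeAt_bondInd_ne_zero_apply {ρ : Fin n → ℤ} {α : Fin n} {q : Fin n → ℤ} {N : ℕ} {z : Fin n → ℤ}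
    (h : treeGaugeAt ρ (bondInd α q) N z ≠ 0) {j : Fin n} (hj : j ≠ α) :
    q j = if (α : ℕ) < j then z j else ((N : ℤ) • blk N z + ρ) j :=
  axialAux_bondInd_sum_ne_zero_apply α q _ z n h j hj

/-! ## §2 The hyperplane count at an in-block root offset `r`, one axis order -/

/-- [folklore] A sum of integers of modulus `≤ 1` over `S` is at most the number of points of any set `T` containing the support. -/
theorem sum_abs_le_card_of_support {ι : Type*} (S T : Finset ι) (f : ι → ℤ) (h1 : ∀ b, |f b| ≤ 1)
    (hT : ∀ b ∈ S, f b ≠ 0 → b ∈ T) : ∑ b ∈ S, |f b| ≤ (T.card : ℤ) := by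
  classical
  have e : ∑ b ∈ S, |f b| = ∑ b ∈ S.filter (fun b => f b ≠ 0), |f b| := by
    rw [Finset.sum_filter]
    refine Finset.sum_congr rfl fun b _ => ?_
    by_cases h : f b ≠ 0
    · rw [if_pos h]
    · rw [if_neg h, not_not.1 h, abs_zero]
  rw [e]
  calc ∑ b ∈ S.filter (fun b => f b ≠ 0), |f b|
      ≤ ∑ _b ∈ S.filter (fun b => f b ≠ 0), (1 : ℤ) := Finset.sum_le_sum fun b _ => h1 b
    _ = ((S.filter (fun b => f b ≠ 0)).card : ℤ) := by rw [Finset.sum_const, nsmul_eq_mul, mul_one]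
    _ ≤ (T.card : ℤ) := by
        exact_mod_cast Finset.card_le_card fun b hb => by
          rw [Finset.mem_filter] at hb
          exact hT b hb.1 hb.2

/-- [folklore] In block coordinates: if the tree contour of the block point `N•Y + b` (root offset `r`) reads the bond `(α, N•Y + b′)`, then `b′_j = b_j` for `α < j` and
`b′_j = r_j` for `j < α`. -/
theorem apply_eq_of_treeGaugeAt_ne_zero {N : ℕ} {r : Fin n → ℕ} {Y : Fin n → ℤ} {α : Fin n} {b' b : Fin n → ℕ} (hb : b ∈ box n N)
    (h : treeGaugeAt (toSite r) (bondInd α ((N : ℤ) • Y + toSite b')) N ((N : ℤ) • Y + toSite b) ≠ 0) {j : Fin n} (hj : j ≠ α) :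
    b' j = if (α : ℕ) < j then b j else r j := by
  have e := treeGaugeAt_bondInd_ne_zero_apply h hj
  rw [blk_block Y hb] at e
  simp only [Pi.add_apply, Pi.smul_apply, smul_eq_mul, toSite] at e
  split_ifs at e with hlt
  · rw [if_pos hlt]; exact_mod_cast (add_left_cancel e)
  · rw [if_neg hlt]; exact_mod_cast (add_left_cancel e)

/-- [folklore] **THE HYPERPLANE COUNT**: for an in-block root offset `r`, a coordinate hyperplane `{b′_i = v}` with `v ≠ r_i` and ANY axis `α`, the bonds `(α, N•Y + b′)` based in
the hyperplane are read by the tree contours of the `N^n` block points at most `N^n` times IN TOTAL (not `N^{n+1}`): from axes `α > i`… none (`b′_i = r_i` would be forced);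
for `α = i` the base point is pinned by the target; for `α < i` the target lies in the hyperplane (`N^{n−1}` targets, `≤ N` base points each). -/
theorem sum_hyperplane_box_abs_treeGaugeAt_le {N : ℕ} (r : Fin n → ℕ) (Y : Fin n → ℤ) (i : Fin n) {v : ℕ} (hv : v ≠ r i) (α : Fin n) :
    ∑ b' ∈ (box n N).filter (fun b' => b' i = v), ∑ b ∈ box n N,
        |treeGaugeAt (toSite r) (bondInd α ((N : ℤ) • Y + toSite b')) N ((N : ℤ) • Y + toSite b)| ≤ (N : ℤ) ^ n := by
  classical
  rw [Finset.sum_comm]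
  have hn : 1 ≤ n := Nat.succ_le_of_lt (Fin.pos α)
  have hcard : (box n N).card = N ^ n := by simp [AffineAveraging.box, Fintype.card_piFinset]
  -- the candidate base points for the target `b`: all coordinates but `α` are pinned
  set g : (Fin n → ℕ) → ℕ → (Fin n → ℕ) := fun b t j => if j = α then t else if (α : ℕ) < j then b j else r j with hg
  have hpin : ∀ b ∈ box n N, ∀ b' ∈ (box n N).filter (fun b' => b' i = v),
      treeGaugeAt (toSite r) (bondInd α ((N : ℤ) • Y + toSite b')) N ((N : ℤ) • Y + toSite b) ≠ 0 → b' = g b (b' α) ∧ b' i = v ∧ b' α < N := by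
    intro b hb b' hb' h
    rw [Finset.mem_filter] at hb'
    refine ⟨funext fun j => ?_, hb'.2, Finset.mem_range.1 (Fintype.mem_piFinset.1 hb'.1 α)⟩
    by_cases hjα : j = α
    · rw [hjα, hg]; simp only [if_true]
    · rw [hg]; simp only [if_neg hjα]; exact apply_eq_of_treeGaugeAt_ne_zero hb h hjα
  by_cases hiα : (i : ℕ) < α
  · -- no bond of the hyperplane is read from an axis later than `i`
    have h0 : ∀ b ∈ box n N, ∑ b' ∈ (box n N).filter (fun b' => b' i = v),
        |treeGaugeAt (toSite r) (bondInd α ((N : ℤ) • Y + toSite b')) N ((N : ℤ) • Y + toSite b)| = 0 := by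
      intro b hb
      refine Finset.sum_eq_zero fun b' hb' => ?_
      rw [abs_eq_zero]
      by_contra h
      obtain ⟨e, hi, -⟩ := hpin b hb b' hb' h
      have hiα' : i ≠ α := fun h' => by rw [h'] at hiα; exact lt_irrefl _ hiα
      have e' := congrFun e i
      rw [hi, hg] at e'
      simp only [if_neg hiα', if_neg (not_lt.2 hiα.le)] at e'
      exact hv e'
    rw [Finset.sum_congr rfl h0, Finset.sum_const_zero]
    positivity
  · by_cases hαi : α = i
    · -- `α = i`: the base point is pinned completely
      calc ∑ b ∈ box n N, ∑ b' ∈ (box n N).filter (fun b' => b' i = v),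
            |treeGaugeAt (toSite r) (bondInd α ((N : ℤ) • Y + toSite b')) N ((N : ℤ) • Y + toSite b)|
          ≤ ∑ b ∈ box n N, ((({g b v} : Finset (Fin n → ℕ)).card : ℤ)) :=
            Finset.sum_le_sum fun b hb => sum_abs_le_card_of_support _ _ _ (fun b' => abs_treeGaugeAt_bondInd_le_one _ _ _ _ _)
              fun b' hb' h => by
                obtain ⟨e, hi, -⟩ := hpin b hb b' hb' h
                rw [Finset.mem_singleton]
                have hα : b' α = v := by rw [hαi]; exact hi
                rw [← hα]; exact e
        _ = (N : ℤ) ^ n := by rw [Finset.sum_congr rfl fun b _ => by rw [Finset.card_singleton], Finset.sum_const, hcard]; simp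
    · -- `α < i`: the target lies in the hyperplane
      have hlt : (α : ℕ) < i := lt_of_le_of_ne (not_lt.1 hiα) fun h => hαi (Fin.ext h)
      have hiα' : i ≠ α := fun h' => hαi h'.symm
      calc ∑ b ∈ box n N, ∑ b' ∈ (box n N).filter (fun b' => b' i = v),
            |treeGaugeAt (toSite r) (bondInd α ((N : ℤ) • Y + toSite b')) N ((N : ℤ) • Y + toSite b)|
          ≤ ∑ b ∈ box n N, (if b i = v then (N : ℤ) else 0) := by
            refine Finset.sum_le_sum fun b hb => ?_
            split_ifs with hbi
            · refine (sum_abs_le_card_of_support _ ((Finset.range N).image (g b)) _ (fun b' => abs_treeGaugeAt_bondInd_le_one _ _ _ _ _)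
                fun b' hb' h => ?_).trans ?_
              · obtain ⟨e, -, hlt'⟩ := hpin b hb b' hb' h
                exact Finset.mem_image.2 ⟨b' α, Finset.mem_range.2 hlt', e.symm⟩
              · exact_mod_cast Finset.card_image_le.trans (Finset.card_range N).le
            · refine le_of_eq (Finset.sum_eq_zero fun b' hb' => ?_)
              rw [abs_eq_zero]
              by_contra h
              obtain ⟨e, hi, -⟩ := hpin b hb b' hb' h
              have e' := congrFun e i
              rw [hi, hg] at e'
              simp only [if_neg hiα', if_pos hlt] at e'
              exact hbi e'.symm
        _ = (N : ℤ) * (((box n N).filter (fun b => b i = v)).card : ℤ) := by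
            rw [← Finset.sum_filter, Finset.sum_const, nsmul_eq_mul, mul_comm]
        _ ≤ (N : ℤ) * (N : ℤ) ^ (n - 1) := by
            refine mul_le_mul_of_nonneg_left ?_ (by positivity)
            have hc : ((box n N).filter (fun b => b i = v)).card ≤ N ^ (n - 1) := by
              rw [AffineAveraging.box, Fintype.card_filter_piFinset_const]
              split_ifs
              · rw [Finset.card_range, Fintype.card_fin]
              · exact Nat.zero_le _
            exact_mod_cast hc
        _ = (N : ℤ) ^ n := by rw [mul_comm, ← pow_succ, Nat.sub_add_cancel hn]

/-- [folklore] The hyperplane count summed over the axes: `≤ n·N^n`. -/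
theorem sum_univ_hyperplane_box_abs_treeGaugeAt_le {N : ℕ} (r : Fin n → ℕ) (Y : Fin n → ℤ) (i : Fin n) {v : ℕ} (hv : v ≠ r i) :
    ∑ α : Fin n, ∑ b' ∈ (box n N).filter (fun b' => b' i = v), ∑ b ∈ box n N,
        |treeGaugeAt (toSite r) (bondInd α ((N : ℤ) • Y + toSite b')) N ((N : ℤ) • Y + toSite b)| ≤ (n : ℤ) * (N : ℤ) ^ n := by
  refine (Finset.sum_le_sum fun α _ => sum_hyperplane_box_abs_treeGaugeAt_le r Y i hv α).trans ?_
  rw [Finset.sum_const, Finset.card_univ, Fintype.card_fin, nsmul_eq_mul]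

/-! ## §3 an1's comb weights: the symmetrised count at the centred root -/

/-- [folklore] Rotating a four-fold finite sum: the innermost index to the front. -/
theorem sum_sum_sum_sum_rotate {ι₁ ι₂ ι₃ ι₄ : Type*} (s₁ : Finset ι₁) (s₂ : Finset ι₂) (s₃ : Finset ι₃) (s₄ : Finset ι₄)
    (f : ι₁ → ι₂ → ι₃ → ι₄ → ℝ) :
    ∑ a ∈ s₁, ∑ b ∈ s₂, ∑ c ∈ s₃, ∑ e ∈ s₄, f a b c e = ∑ e ∈ s₄, ∑ a ∈ s₁, ∑ b ∈ s₂, ∑ c ∈ s₃, f a b c e := by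
  calc ∑ a ∈ s₁, ∑ b ∈ s₂, ∑ c ∈ s₃, ∑ e ∈ s₄, f a b c e
      = ∑ a ∈ s₁, ∑ b ∈ s₂, ∑ e ∈ s₄, ∑ c ∈ s₃, f a b c e :=
        Finset.sum_congr rfl fun a _ => Finset.sum_congr rfl fun b _ => Finset.sum_comm
    _ = ∑ a ∈ s₁, ∑ e ∈ s₄, ∑ b ∈ s₂, ∑ c ∈ s₃, f a b c e := Finset.sum_congr rfl fun a _ => Finset.sum_comm
    _ = ∑ e ∈ s₄, ∑ a ∈ s₁, ∑ b ∈ s₂, ∑ c ∈ s₃, f a b c e := Finset.sum_comm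

variable {d : ℕ}

/-- [folklore] The coordinate permutation transports the hyperplane count: for every `σ`, the `σ`-twisted count equals the straight count at the permuted coarse point and the
permuted axis, hence is `≤ (d+1)·N^{d+1}` (`v ≠ (N−1)∕2`, the centred root's common coordinate). -/
theorem sum_twisted_hyperplane_le {N : ℕ} (Y : Fin (d + 1) → ℤ) (i : Fin (d + 1)) {v : ℕ} (hv : v ≠ (N - 1) / 2) (σ : Equiv.Perm (Fin (d + 1))) :
    ∑ α : Fin (d + 1), ∑ b' ∈ (box (d + 1) N).filter (fun b' => b' i = v), ∑ b ∈ box (d + 1) N,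
        |treeGaugeAt ((psite σ).symm (ctr (d + 1) N)) (bondInd (σ.symm α) ((psite σ).symm ((N : ℤ) • Y + toSite b'))) N
            ((psite σ).symm ((N : ℤ) • Y + toSite b))| ≤ ((d + 1 : ℕ) : ℤ) * (N : ℤ) ^ (d + 1) := by
  classical
  have hroot : (psite σ).symm (ctr (d + 1) N) = toSite (ctrOff (d + 1) N) := rfl
  have hpt : ∀ c : Fin (d + 1) → ℕ, (psite σ).symm ((N : ℤ) • Y + toSite c) = (N : ℤ) • (psite σ).symm Y + toSite ((psite σ).symm c) := fun c => rfl
  simp only [hroot, hpt]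
  have h := sum_univ_hyperplane_box_abs_treeGaugeAt_le (N := N) (ctrOff (d + 1) N) ((psite σ).symm Y) (σ.symm i) (v := v) hv
  refine le_of_eq_of_le ?_ h
  -- re-index `α ↦ σ.symm α`, `b′ ↦ (psite σ).symm b′`, `b ↦ (psite σ).symm b`
  refine Fintype.sum_equiv σ.symm _ _ fun α => ?_
  refine Finset.sum_equiv (psite σ).symm (fun b' => ?_) (fun b' _ => ?_)
  · simp only [Finset.mem_filter, psite_symm_apply, Equiv.apply_symm_apply]
    constructor
    · rintro ⟨hb, hi⟩; exact ⟨psite_symm_mem_box σ hb, hi⟩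
    · rintro ⟨hb, hi⟩
      refine ⟨?_, hi⟩
      have := psite_mem_box σ hb
      simpa using this
  · refine Finset.sum_equiv (psite σ).symm (fun b => ?_) (fun b _ => rfl)
    constructor
    · exact fun hb => psite_symm_mem_box σ hb
    · intro hb
      have := psite_mem_box σ hb
      simpa using this

/-- [folklore] **THE HYPERPLANE MASS OF an1's COMB WEIGHTS**: for every coarse point `Y`, axis `i` and level `v ≠ (N−1)∕2`,
`Σ_α Σ_{b′ ∈ box (d+1) N, b′_i = v} |lam04 N α (N•Y + toSite b′) Y| ≤ (d+1)·N^{d+1}` — ONE POWER BELOW the block total `N^{d+1}·((d+1)·N)` of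
`BondIndicatorGaugeL1.sum_univ_box_abs_lam04_le`: the comb-weight mass CONCENTRATES ON THE ROOT's AXIAL CROSS, not on the block's faces. -/
theorem sum_hyperplane_abs_lam04_le {N : ℕ} (Y : Fin (d + 1) → ℤ) (i : Fin (d + 1)) {v : ℕ} (hv : v ≠ (N - 1) / 2) :
    ∑ α : Fin (d + 1), ∑ b' ∈ (box (d + 1) N).filter (fun b' => b' i = v), |lam04 N α ((N : ℤ) • Y + toSite b') Y|
      ≤ ((d : ℝ) + 1) * (N : ℝ) ^ (d + 1) := by
  classical
  have hf : (0 : ℝ) < ((d + 1) ! : ℝ) := by exact_mod_cast Nat.factorial_pos _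
  -- each |lam04| ≤ ((d+1)!)⁻¹ Σ_b Σ_σ |treeGaugeAt_σ|
  have hlam : ∀ (α : Fin (d + 1)) (b' : Fin (d + 1) → ℕ), |lam04 N α ((N : ℤ) • Y + toSite b') Y|
      ≤ ((d + 1) ! : ℝ)⁻¹ * ∑ b ∈ box (d + 1) N, ∑ σ : Equiv.Perm (Fin (d + 1)),
          |((treeGaugeAt ((psite σ).symm (ctr (d + 1) N)) (bondInd (σ.symm α) ((psite σ).symm ((N : ℤ) • Y + toSite b'))) N
              ((psite σ).symm ((N : ℤ) • Y + toSite b)) : ℤ) : ℝ)| := by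
    intro α b'
    rw [lam04, SymLamAt_eq_sum_symTreeGaugeAt, abs_mul, abs_inv, Nat.abs_cast]
    refine mul_le_mul_of_nonneg_left ((Finset.abs_sum_le_sum_abs _ _).trans (Finset.sum_le_sum fun b _ => ?_)) (inv_nonneg.2 hf.le)
    rw [← bondIndR_eq_delta1, symTreeGaugeAt_eq_sum]
    refine (Finset.abs_sum_le_sum_abs _ _).trans (Finset.sum_le_sum fun σ _ => le_of_eq ?_)
    rw [P1_bondIndR, treeGaugeAt_bondIndR]
  have hperm : ∀ σ : Equiv.Perm (Fin (d + 1)),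
      ∑ α : Fin (d + 1), ∑ b' ∈ (box (d + 1) N).filter (fun b' => b' i = v), ∑ b ∈ box (d + 1) N,
        |((treeGaugeAt ((psite σ).symm (ctr (d + 1) N)) (bondInd (σ.symm α) ((psite σ).symm ((N : ℤ) • Y + toSite b'))) N
            ((psite σ).symm ((N : ℤ) • Y + toSite b)) : ℤ) : ℝ)| ≤ ((d : ℝ) + 1) * (N : ℝ) ^ (d + 1) := by
    intro σ
    have h := sum_twisted_hyperplane_le (N := N) Y i hv σ
    have e : (((d + 1 : ℕ) : ℤ) : ℝ) = (d : ℝ) + 1 := by push_cast; ring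
    rw [← e]
    exact_mod_cast h
  calc ∑ α : Fin (d + 1), ∑ b' ∈ (box (d + 1) N).filter (fun b' => b' i = v), |lam04 N α ((N : ℤ) • Y + toSite b') Y|
      ≤ ∑ α : Fin (d + 1), ∑ b' ∈ (box (d + 1) N).filter (fun b' => b' i = v), ((d + 1) ! : ℝ)⁻¹ * ∑ b ∈ box (d + 1) N,
          ∑ σ : Equiv.Perm (Fin (d + 1)),
            |((treeGaugeAt ((psite σ).symm (ctr (d + 1) N)) (bondInd (σ.symm α) ((psite σ).symm ((N : ℤ) • Y + toSite b'))) N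
              ((psite σ).symm ((N : ℤ) • Y + toSite b)) : ℤ) : ℝ)| := Finset.sum_le_sum fun α _ => Finset.sum_le_sum fun b' _ => hlam α b'
    _ = ((d + 1) ! : ℝ)⁻¹ * ∑ σ : Equiv.Perm (Fin (d + 1)), ∑ α : Fin (d + 1), ∑ b' ∈ (box (d + 1) N).filter (fun b' => b' i = v),
          ∑ b ∈ box (d + 1) N,
            |((treeGaugeAt ((psite σ).symm (ctr (d + 1) N)) (bondInd (σ.symm α) ((psite σ).symm ((N : ℤ) • Y + toSite b'))) N
              ((psite σ).symm ((N : ℤ) • Y + toSite b)) : ℤ) : ℝ)| := by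
        simp only [← Finset.mul_sum]
        congr 1
        exact sum_sum_sum_sum_rotate _ _ _ _ fun α b' b σ =>
          |((treeGaugeAt ((psite σ).symm (ctr (d + 1) N)) (bondInd (σ.symm α) ((psite σ).symm ((N : ℤ) • Y + toSite b'))) N
              ((psite σ).symm ((N : ℤ) • Y + toSite b)) : ℤ) : ℝ)|
    _ ≤ ((d + 1) ! : ℝ)⁻¹ * ∑ _σ : Equiv.Perm (Fin (d + 1)), (((d : ℝ) + 1) * (N : ℝ) ^ (d + 1)) :=
        mul_le_mul_of_nonneg_left (Finset.sum_le_sum fun σ _ => hperm σ) (inv_nonneg.2 hf.le)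
    _ = ((d : ℝ) + 1) * (N : ℝ) ^ (d + 1) := by
        rw [Finset.sum_const, Finset.card_univ, card_perm_fin, nsmul_eq_mul]
        field_simp

/-- [folklore] **THE GEOMETRIC FACES OF A BLOCK CARRY `≤ 2·(d+1)²·N^{d+1}` OF THE COMB-WEIGHT MASS** (`3 ≤ N`, so that the face levels `0`, `N−1` differ from the centred root's
coordinate `(N−1)∕2`): `Σ_α Σ_{b′ ∈ box, ∃ i, b′_i ∈ {0, N−1}} |lam04 N α (N•Y + toSite b′) Y| ≤ 2·(d+1)²·N^{d+1}` — the `2(d+1)` hyperplanes of the previous theorem. -/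
theorem sum_faces_abs_lam04_le {N : ℕ} (hN : 3 ≤ N) (Y : Fin (d + 1) → ℤ) :
    ∑ α : Fin (d + 1), ∑ b' ∈ (box (d + 1) N).filter (fun b' => ∃ i, b' i = 0 ∨ b' i = N - 1), |lam04 N α ((N : ℤ) • Y + toSite b') Y|
      ≤ 2 * ((d : ℝ) + 1) ^ 2 * (N : ℝ) ^ (d + 1) := by
  classical
  have h0 : (0 : ℕ) ≠ (N - 1) / 2 := by omega
  have h1 : N - 1 ≠ (N - 1) / 2 := by omega
  -- the indicator of the union of the faces is dominated by the sum of the hyperplanes' indicators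
  have hdom : ∀ α : Fin (d + 1),
      ∑ b' ∈ (box (d + 1) N).filter (fun b' => ∃ i, b' i = 0 ∨ b' i = N - 1), |lam04 N α ((N : ℤ) • Y + toSite b') Y|
        ≤ ∑ i : Fin (d + 1), (∑ b' ∈ (box (d + 1) N).filter (fun b' => b' i = 0), |lam04 N α ((N : ℤ) • Y + toSite b') Y|
            + ∑ b' ∈ (box (d + 1) N).filter (fun b' => b' i = N - 1), |lam04 N α ((N : ℤ) • Y + toSite b') Y|) := by
    intro α
    simp only [Finset.sum_filter, ← Finset.sum_add_distrib]
    rw [Finset.sum_comm]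
    refine Finset.sum_le_sum fun b' _ => ?_
    split_ifs with hP
    · obtain ⟨i, hi⟩ := hP
      refine le_trans ?_ (Finset.single_le_sum (f := fun j => (if b' j = 0 then |lam04 N α ((N : ℤ) • Y + toSite b') Y| else 0)
          + (if b' j = N - 1 then |lam04 N α ((N : ℤ) • Y + toSite b') Y| else 0)) (fun j _ => by positivity) (Finset.mem_univ i))
      rcases hi with hi | hi
      · simp only [hi, if_true]
        exact le_add_of_nonneg_right (by positivity)
      · simp only [hi, if_true]
        exact le_add_of_nonneg_left (by positivity)
    · positivity
  calc ∑ α : Fin (d + 1), ∑ b' ∈ (box (d + 1) N).filter (fun b' => ∃ i, b' i = 0 ∨ b' i = N - 1), |lam04 N α ((N : ℤ) • Y + toSite b') Y|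
      ≤ ∑ α : Fin (d + 1), ∑ i : Fin (d + 1), (∑ b' ∈ (box (d + 1) N).filter (fun b' => b' i = 0), |lam04 N α ((N : ℤ) • Y + toSite b') Y|
            + ∑ b' ∈ (box (d + 1) N).filter (fun b' => b' i = N - 1), |lam04 N α ((N : ℤ) • Y + toSite b') Y|) := Finset.sum_le_sum fun α _ => hdom α
    _ = ∑ i : Fin (d + 1), (∑ α : Fin (d + 1), ∑ b' ∈ (box (d + 1) N).filter (fun b' => b' i = 0), |lam04 N α ((N : ℤ) • Y + toSite b') Y|
            + ∑ α : Fin (d + 1), ∑ b' ∈ (box (d + 1) N).filter (fun b' => b' i = N - 1), |lam04 N α ((N : ℤ) • Y + toSite b') Y|) := by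
        rw [Finset.sum_comm]
        exact Finset.sum_congr rfl fun i _ => Finset.sum_add_distrib
    _ ≤ ∑ _i : Fin (d + 1), (((d : ℝ) + 1) * (N : ℝ) ^ (d + 1) + ((d : ℝ) + 1) * (N : ℝ) ^ (d + 1)) :=
        Finset.sum_le_sum fun i _ => add_le_add (sum_hyperplane_abs_lam04_le Y i h0) (sum_hyperplane_abs_lam04_le Y i h1)
    _ = 2 * ((d : ℝ) + 1) ^ 2 * (N : ℝ) ^ (d + 1) := by
        rw [Finset.sum_const, Finset.card_univ, Fintype.card_fin, nsmul_eq_mul]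
        push_cast
        ring

/-- [folklore] **THE HYPERPLANE MASS OF `Dsh`'s FIELD–MULTIPLIER BLOCK, OWN BLOCK**: at the coarse point `N•Y`, direction `m`, the bonds of `B(Y)` based in `{b′_i = v}`,
`v ≠ (N−1)∕2`, carry `Σ_α Σ_{b′: b′_i = v} |Dsh N (N•Y + toSite b′) (N•Y) (inl α) (inr m)| ≤ (d+1)·N^{d+1}` (one-point support kills the reading at `Y + e_m`). -/
theorem sum_hyperplane_abs_Dsh_le {N : ℕ} [NeZero N] (hN : 1 ≤ N) (Y : Fin (d + 1) → ℤ) (m i : Fin (d + 1)) {v : ℕ} (hv : v ≠ (N - 1) / 2) :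
    ∑ α : Fin (d + 1), ∑ b' ∈ (box (d + 1) N).filter (fun b' => b' i = v),
        |Dsh N ((N : ℤ) • Y + toSite b') ((N : ℤ) • Y) (Sum.inl α) (Sum.inr m)| ≤ ((d : ℝ) + 1) * (N : ℝ) ^ (d + 1) := by
  refine (Finset.sum_le_sum fun α _ => Finset.sum_le_sum fun b' hb' => ?_).trans (sum_hyperplane_abs_lam04_le Y i hv)
  rw [Finset.mem_filter] at hb'
  rw [Dsh_inl_inr, if_pos (proj_zsmul Y), quo_zsmul, dz]
  have hne : Y + unitVec m ≠ blk N ((N : ℤ) • Y + toSite b') := by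
    rw [blk_block Y hb'.1]; intro h
    have := congrFun h m
    simp [unitVec_apply] at this
  rw [lam04_eq_zero_of_ne_blk hN hne, zero_sub, abs_neg]

/-- [folklore] **THE HYPERPLANE MASS OF `Dsh`'s FIELD–MULTIPLIER BLOCK, NEIGHBOURING BLOCK** `B(Y + e_m)`: the same bound (there the reading at `Y` vanishes). -/
theorem sum_hyperplane_abs_Dsh_succ_le {N : ℕ} [NeZero N] (hN : 1 ≤ N) (Y : Fin (d + 1) → ℤ) (m i : Fin (d + 1)) {v : ℕ} (hv : v ≠ (N - 1) / 2) :
    ∑ α : Fin (d + 1), ∑ b' ∈ (box (d + 1) N).filter (fun b' => b' i = v),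
        |Dsh N ((N : ℤ) • (Y + unitVec m) + toSite b') ((N : ℤ) • Y) (Sum.inl α) (Sum.inr m)| ≤ ((d : ℝ) + 1) * (N : ℝ) ^ (d + 1) := by
  refine (Finset.sum_le_sum fun α _ => Finset.sum_le_sum fun b' hb' => ?_).trans (sum_hyperplane_abs_lam04_le (Y + unitVec m) i hv)
  rw [Finset.mem_filter] at hb'
  rw [Dsh_inl_inr, if_pos (proj_zsmul Y), quo_zsmul, dz]
  have hne : Y ≠ blk N ((N : ℤ) • (Y + unitVec m) + toSite b') := by
    rw [blk_block (Y + unitVec m) hb'.1]; intro h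
    have := congrFun h m
    simp [unitVec_apply] at this
  rw [lam04_eq_zero_of_ne_blk hN hne, sub_zero]

end Summit.QuantumFields.BalabanUV.Beta.D1BFx.DshFaceMass

end
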